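import Mathlib
import Summits.ValiantsHypothesis.ValiantsHypothesis.Theorems.FifoMatchingNNDivisionHardCorSandwich
import Literature.Barriers.PneNP.ExtendedFormulationLinearImage
import Literature.Barriers.PneNP.CorrelationPolytopeXCLowerBoundGraph
import Literature.Combinatorics.Optimization.CorrelationPolytopeGridMinor
import Literature.Barriers.PneNP.ExtendedFormulationMinkowskiFaces
import Summits.ValiantsHypothesis.ValiantsHypothesis.Theorems.FifoMatchingXcDivisionZmixFace
import Summits.ValiantsHypothesis.ValiantsHypothesis.Theorems.FifoMatchingNNDivisionHardSwitchedFaceTower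

/-!
# FifoMatching · NNDivisionHard — THE LOCALIZATION FUNCTOR `Loc` on decided passenger classes (part 1/4: §0–§4)

Theorems-grade port (bytes staged by val-idea-43 g5 for a port hand) of the crux workfile `Cruxes/NNDivisionHard/Localization43.lean` rev 5
@6763e14e8ba5 (val-idea-43 g5, W6-P2 co-seat; crux `stmt-ValiantsHypothesis-21181` `FifoMatching.NNDivisionHard`; crit-9 g2 V#47 / V#53 VERIFIED KEEP) —
the full commentary (enemy readings N19–N23, currency remarks, honest weight) stays in that workfile's module docstring; statements and
proofs below are VERBATIM, the namespace is `…Theorems.FifoMatching.Localization` and `T` is a local `abbrev` δ-equal to `XcDivision.T`.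

Part 1: §0 the target `CorVirtualHard` (verbatim), currency `Fam`/`PClass`/`Decided`/`ResidualLaw`; §1 the deletion minor `π_ι`
(`delRead`, `delRead_image_cor`, `hasEFOfSize_pair_del`); §2 the exchange `T c h ≤ T (2c) ℓ` for `ℓ ≥ √h`; §3 ★ `decided_loc : Decided X →
Decided (Loc X)` (+ budgeted `decidedB_loc`); §4 ★★ `corVirtualHard_of_residualLawLoc`, `enemy_hereditary`.
-/

set_option linter.unusedVariables false
set_option linter.unusedSectionVars false
set_option linter.dupNamespace false

namespace Summit.ValiantsHypothesis.ValiantsHypothesis.Theorems.FifoMatching.Localization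

open Matrix Finset
open scoped Pointwise
open Literature.Barriers.PneNP (HasEFOfSize corPolytopeGraph_top_two_pow_half_le)
open Literature.Combinatorics.Optimization (corPolytopeGraph corVec corVec_apply_diag corVec_apply_adj corVec_zero_or_one)
open Summit.ValiantsHypothesis.ValiantsHypothesis.Theorems.FifoMatching (XcDivision.dot_le_of_mem_convexHull XcDivision.convexHull_range_inter_eq)
open Summit.ValiantsHypothesis.ValiantsHypothesis.Theorems.FifoMatching.CorSandwich (threshold_lt_of_rpow_bound)

/-! ## §0 The target, restated VERBATIM from the line (§1 `VPLine.CorVirtualHard`; socket for the pen = `id`) -/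

/-- the route threshold `T c n = 2^((log₂ n + c)^c)` — δ-equal to the line's `XcDivision.T` (`Cruxes/NNLinearDegreeCofactorHard/Lines/xc_division.lean`),
restated so that this Theorems-grade file imports no crux workfile. -/
abbrev T (c n : ℕ) : ℕ := 2 ^ ((Nat.log 2 n + c) ^ c)


/-- **COR-VIRTUAL (the budgeted law; = vxc(COR(K_h)) super-quasi-polynomial, Hertrich–Loho Q5.1 at COR)** — verbatim copy of
`…Cruxes.NNLinearDegreeCofactorHard.XcDivision.VPLine.CorVirtualHard` of `Lines/virtual_passenger.lean` (same constants `T`,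
`corPolytopeGraph`, `HasEFOfSize`), which the line turns into the crux by `nnDivisionHard_of_corVirtual`. -/
def CorVirtualHard : Prop :=
  ∀ c : ℕ, ∃ h₀ : ℕ, ∀ h ≥ h₀, ∀ (K : ℕ) (q : Fin (K + 1) → (Fin h × Fin h → ℝ)) (r : ℕ),
    HasEFOfSize (convexHull ℝ (Set.range q)) r →
    HasEFOfSize (corPolytopeGraph (⊤ : SimpleGraph (Fin h)) + convexHull ℝ (Set.range q)) r → T c h < r

/-- generator families of a passenger at scale `h` (the line's `q : Fin (K + 1) → (Fin h × Fin h → ℝ)`). -/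
abbrev Fam (h K : ℕ) : Type := Fin (K + 1) → (Fin h × Fin h → ℝ)

/-- a PASSENGER CLASS: a predicate on generator families at every scale (each of the line's fourteen classes is one, e.g.
`fun h K q => CommonExtremiser h q`, `fun h K q => Shallow h q`, `fun h K q => MixedRooted τ₀ h q`). -/
abbrev PClass : Type := ∀ h K : ℕ, Fam h K → Prop

/-- «class `X` is DECIDED»: the exact shape of every class theorem of the line (`shallow_decided hW`, `cutDominant_decided hM`,
`nearRooted_decided hU`, `rate_of_lvl ∘ …_three_halves_pow_le`, …): membership plus a size-`r` extended formulation of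
`COR(K_h) + conv q` forces `T c h < r`, eventually in `h`, for every `c`.  (No budget hypothesis: none of the fourteen uses it.) -/
def Decided (X : PClass) : Prop :=
  ∀ c : ℕ, ∃ h₀ : ℕ, ∀ h ≥ h₀, ∀ (K : ℕ) (q : Fam h K) (r : ℕ),
    X h K q → HasEFOfSize (corPolytopeGraph (⊤ : SimpleGraph (Fin h)) + convexHull ℝ (Set.range q)) r → T c h < r

/-- «the RESIDUAL LAW relative to the cone `X`»: every BUDGETED pair outside `X` is hard — the shape of the line's research stub
(`CoreLaw` = `ResidualLaw` of the disjunction of the fourteen class predicates at `θ = 1/2`, `τ = τ₀`). -/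
def ResidualLaw (X : PClass) : Prop :=
  ∀ c : ℕ, ∃ h₀ : ℕ, ∀ h ≥ h₀, ∀ (K : ℕ) (q : Fam h K) (r : ℕ),
    ¬ X h K q → HasEFOfSize (convexHull ℝ (Set.range q)) r →
    HasEFOfSize (corPolytopeGraph (⊤ : SimpleGraph (Fin h)) + convexHull ℝ (Set.range q)) r → T c h < r

/-- **the partition glue, abstractly** (= the line's `corVirtualHard_of_partition'` with the case analysis packed into `X`). -/
theorem corVirtualHard_of_residualLaw {X : PClass} (hX : Decided X) (hR : ResidualLaw X) : CorVirtualHard := by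
  intro c
  obtain ⟨h₁, hh₁⟩ := hX c
  obtain ⟨h₂, hh₂⟩ := hR c
  refine ⟨h₁ + h₂, fun h hh K q r hB hEF => ?_⟩
  by_cases hq : X h K q
  · exact hh₁ h (by omega) K q r hq hEF
  · exact hh₂ h (by omega) K q r hq hB hEF

/-- a larger cone leaves a weaker residual law. -/
theorem residualLaw_mono {X Y : PClass} (hXY : ∀ h K (q : Fam h K), X h K q → Y h K q) (hR : ResidualLaw X) :
    ResidualLaw Y := by
  intro c
  obtain ⟨h₀, hh₀⟩ := hR c
  exact ⟨h₀, fun h hh K q r hq hB hEF => hh₀ h hh K q r (fun hx => hq (hXY h K q hx)) hB hEF⟩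

/-- decidedness is monotone the other way: a sub-population of a decided class is decided. -/
theorem decided_anti {X Y : PClass} (hXY : ∀ h K (q : Fam h K), X h K q → Y h K q) (hY : Decided Y) : Decided X := by
  intro c
  obtain ⟨h₀, hh₀⟩ := hY c
  exact ⟨h₀, fun h hh K q r hq hEF => hh₀ h hh K q r (hXY h K q hq) hEF⟩

/-- the union of two decided classes is decided (how the line's fourteen `by_cases` become one cone). -/
theorem decided_or {X Y : PClass} (hX : Decided X) (hY : Decided Y) : Decided (fun h K q => X h K q ∨ Y h K q) := by
  intro c
  obtain ⟨h₁, hh₁⟩ := hX c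
  obtain ⟨h₂, hh₂⟩ := hY c
  refine ⟨h₁ + h₂, fun h hh K q r hq hEF => ?_⟩
  rcases hq with hq | hq
  · exact hh₁ h (by omega) K q r hq hEF
  · exact hh₂ h (by omega) K q r hq hEF

/-! ## §1 The deletion minor `π_ι` -/

/-- the coordinate-DELETION read along an injection `ι : Fin ℓ ↪ Fin h`: `(π_ι x) (i, j) = x (ι i, ι j)`. -/
def delRead {ℓ h : ℕ} (ι : Fin ℓ ↪ Fin h) : (Fin h × Fin h → ℝ) →ₗ[ℝ] (Fin ℓ × Fin ℓ → ℝ) :=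
  LinearMap.funLeft ℝ ℝ (fun ij : Fin ℓ × Fin ℓ => (ι ij.1, ι ij.2))

/-- entrywise formula of the deletion-minor read `π_ι`: `(π_ι x)(i,j) = x(ι i, ι j)`. -/
theorem delRead_apply {ℓ h : ℕ} (ι : Fin ℓ ↪ Fin h) (x : Fin h × Fin h → ℝ) (i j : Fin ℓ) :
    delRead ι x (i, j) = x (ι i, ι j) := rfl

/-- the identity read changes nothing. -/
theorem delRead_refl {h : ℕ} (x : Fin h × Fin h → ℝ) : delRead (Function.Embedding.refl (Fin h)) x = x := by
  funext ij
  rfl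

/-- reads compose: a minor of a minor is a minor. -/
theorem delRead_trans {m ℓ h : ℕ} (κ : Fin m ↪ Fin ℓ) (ι : Fin ℓ ↪ Fin h) (x : Fin h × Fin h → ℝ) :
    delRead κ (delRead ι x) = delRead (κ.trans ι) x := by
  funext ij
  rfl

/-- `π_ι` of a `COR(K_h)` vertex is the `COR(K_ℓ)` vertex of the restricted subset. -/
theorem delRead_corVec {ℓ h : ℕ} (ι : Fin ℓ ↪ Fin h) (b : Fin h → Bool) :
    delRead ι (corVec (⊤ : SimpleGraph (Fin h)) b) = corVec (⊤ : SimpleGraph (Fin ℓ)) (b ∘ ι) := by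
  funext ij
  obtain ⟨i, j⟩ := ij
  rw [delRead_apply]
  unfold corVec
  simp only [SimpleGraph.top_adj, Function.comp, ι.injective.eq_iff, ne_eq]
  by_cases hij : i = j
  · simp [hij]
  · simp [hij]

/-- ★ **the deletion minor of `COR(K_h)` is `COR(K_ℓ)`** (onto: every subset of the minor extends). -/
theorem delRead_image_cor {ℓ h : ℕ} (ι : Fin ℓ ↪ Fin h) :
    delRead ι '' corPolytopeGraph (⊤ : SimpleGraph (Fin h)) = corPolytopeGraph (⊤ : SimpleGraph (Fin ℓ)) := by
  unfold corPolytopeGraph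
  rw [LinearMap.image_convexHull, ← Set.range_comp]
  congr 1
  ext y
  constructor
  · rintro ⟨b, rfl⟩
    exact ⟨b ∘ ι, (delRead_corVec ι b).symm⟩
  · rintro ⟨a, rfl⟩
    refine ⟨Function.extend ι a (fun _ => false), ?_⟩
    show delRead ι (corVec ⊤ (Function.extend ι a (fun _ => false))) = corVec ⊤ a
    rw [delRead_corVec]
    congr 1
    funext p
    exact ι.injective.extend_apply _ _ p

/-- the passenger rides along: `π_ι (conv q) = conv (π_ι ∘ q)`. -/
theorem delRead_image_hull {ℓ h K : ℕ} (ι : Fin ℓ ↪ Fin h) (q : Fam h K) :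
    delRead ι '' convexHull ℝ (Set.range q) = convexHull ℝ (Set.range (⇑(delRead ι) ∘ q)) := by
  rw [LinearMap.image_convexHull, ← Set.range_comp]

/-- BUDGETS survive deletion (`xc` of a linear image, Literature `HasEFOfSize.image_linearMap`). -/
theorem hasEFOfSize_hull_del {ℓ h K : ℕ} (ι : Fin ℓ ↪ Fin h) (q : Fam h K) {r : ℕ}
    (hB : HasEFOfSize (convexHull ℝ (Set.range q)) r) :
    HasEFOfSize (convexHull ℝ (Set.range (⇑(delRead ι) ∘ q))) r := by
  have h1 := hB.image_linearMap (delRead ι)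
  rwa [delRead_image_hull] at h1

/-- ★ SIZES survive deletion: an EF of `COR(K_h) + conv q` of size `r` gives one of `COR(K_ℓ) + conv (π_ι ∘ q)`. -/
theorem hasEFOfSize_pair_del {ℓ h K : ℕ} (ι : Fin ℓ ↪ Fin h) (q : Fam h K) {r : ℕ}
    (hEF : HasEFOfSize (corPolytopeGraph (⊤ : SimpleGraph (Fin h)) + convexHull ℝ (Set.range q)) r) :
    HasEFOfSize (corPolytopeGraph (⊤ : SimpleGraph (Fin ℓ)) + convexHull ℝ (Set.range (⇑(delRead ι) ∘ q))) r := by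
  have h1 := hEF.image_linearMap (delRead ι)
  rwa [Set.image_add, delRead_image_cor, delRead_image_hull] at h1

/-! ## §2 The currency exchange: the `∀ c` quantifier absorbs the loss of scale -/

/-- `log₂ h ≤ 2 log₂ ℓ + 1` once `⌊√h⌋ ≤ ℓ`. -/
theorem log_two_le_of_sqrt_le {h ℓ : ℕ} (hℓ : Nat.sqrt h ≤ ℓ) : Nat.log 2 h ≤ 2 * Nat.log 2 ℓ + 1 := by
  rcases Nat.eq_zero_or_pos h with rfl | hpos
  · simp
  have h1 : h < (ℓ + 1) * (ℓ + 1) :=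
    lt_of_lt_of_le (Nat.lt_succ_sqrt h) (Nat.mul_le_mul (by omega) (by omega))
  have h2 : ℓ < 2 ^ (Nat.log 2 ℓ + 1) := Nat.lt_pow_succ_log_self (by norm_num) ℓ
  have h3 : (ℓ + 1) * (ℓ + 1) ≤ 2 ^ (Nat.log 2 ℓ + 1) * 2 ^ (Nat.log 2 ℓ + 1) :=
    Nat.mul_le_mul (by omega) (by omega)
  have h4 : h < 2 ^ (2 * Nat.log 2 ℓ + 2) := by
    calc h < (ℓ + 1) * (ℓ + 1) := h1
      _ ≤ 2 ^ (Nat.log 2 ℓ + 1) * 2 ^ (Nat.log 2 ℓ + 1) := h3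
      _ = 2 ^ (2 * Nat.log 2 ℓ + 2) := by rw [← pow_add]; ring_nf
  have h5 := Nat.log_lt_of_lt_pow (by omega) h4
  omega

/-- ★ **THE EXCHANGE**: `T c h ≤ T (2c) ℓ` whenever `⌊√h⌋ ≤ ℓ` (`T c n = 2^((log₂ n + c)^c)`). -/
theorem T_le_T_double (c : ℕ) {h ℓ : ℕ} (hℓ : Nat.sqrt h ≤ ℓ) : T c h ≤ T (2 * c) ℓ := by
  have hL := log_two_le_of_sqrt_le hℓ
  show 2 ^ ((Nat.log 2 h + c) ^ c) ≤ 2 ^ ((Nat.log 2 ℓ + 2 * c) ^ (2 * c))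
  apply Nat.pow_le_pow_right (by norm_num)
  rcases Nat.eq_zero_or_pos c with rfl | hc
  · simp
  calc (Nat.log 2 h + c) ^ c ≤ (2 * Nat.log 2 ℓ + 1 + c) ^ c := Nat.pow_le_pow_left (by omega) c
    _ ≤ ((Nat.log 2 ℓ + 2 * c) ^ 2) ^ c := Nat.pow_le_pow_left (by nlinarith) c
    _ = (Nat.log 2 ℓ + 2 * c) ^ (2 * c) := by rw [← pow_mul, mul_comm]

/-! ## §3 The localization functor `Loc` and THE LOCALIZATION THEOREM -/

/-- **`LocAt s X`**: `q` lies in the class `X` on SOME deletion minor of size at least `s h`. -/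
def LocAt (s : ℕ → ℕ) (X : PClass) : PClass := fun h K q =>
  ∃ ℓ : ℕ, s h ≤ ℓ ∧ ∃ ι : Fin ℓ ↪ Fin h, X ℓ K (⇑(delRead ι) ∘ q)

/-- **`Loc X`** — the `√h`-LOCALIZATION of `X`: `q ∈ X` on some deletion minor of size `≥ ⌊√h⌋`. -/
def Loc (X : PClass) : PClass := LocAt Nat.sqrt X

/-- the class itself is the identity minor: `X ≤ Loc X` (so `ResidualLaw (Loc X)` is WEAKER than `ResidualLaw X`). -/
theorem le_loc (X : PClass) {h K : ℕ} {q : Fam h K} (hq : X h K q) : Loc X h K q := by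
  refine ⟨h, Nat.sqrt_le_self h, Function.Embedding.refl (Fin h), ?_⟩
  have e : (⇑(delRead (Function.Embedding.refl (Fin h))) ∘ q) = q := by
    funext j
    exact delRead_refl (q j)
  rw [e]
  exact hq

/-- `X ⊆ LocAt s X` whenever `s h ≤ h`: take the identity minor. -/
theorem le_locAt {s : ℕ → ℕ} (hs : ∀ h, s h ≤ h) (X : PClass) {h K : ℕ} {q : Fam h K} (hq : X h K q) :
    LocAt s X h K q := by
  refine ⟨h, hs h, Function.Embedding.refl (Fin h), ?_⟩
  have e : (⇑(delRead (Function.Embedding.refl (Fin h))) ∘ q) = q := by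
    funext j
    exact delRead_refl (q j)
  rw [e]
  exact hq

/-- `Loc` is monotone in the class. -/
theorem locAt_mono (s : ℕ → ℕ) {X Y : PClass} (hXY : ∀ h K (q : Fam h K), X h K q → Y h K q) {h K : ℕ} {q : Fam h K}
    (hq : LocAt s X h K q) : LocAt s Y h K q := by
  obtain ⟨ℓ, hℓ, ι, hx⟩ := hq
  exact ⟨ℓ, hℓ, ι, hXY _ _ _ hx⟩

/-- **the enemy-side reading (N19)**: `q ∉ Loc X` iff `q` is OUTSIDE `X` ON EVERY deletion minor of size `≥ ⌊√h⌋` — a hereditary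
necessary condition on any refuting pair, for every decided class at once («no quiet minor»). -/
theorem not_loc_iff (X : PClass) {h K : ℕ} (q : Fam h K) :
    ¬ Loc X h K q ↔ ∀ ℓ : ℕ, Nat.sqrt h ≤ ℓ → ∀ ι : Fin ℓ ↪ Fin h, ¬ X ℓ K (⇑(delRead ι) ∘ q) := by
  unfold Loc LocAt
  push Not
  rfl

/-- ★★ **THE LOCALIZATION THEOREM, general scale**: if the scale function `s` is eventually above every constant and the currency
admits an exchange `T c h ≤ T c' ℓ` for `ℓ ≥ s h`, then `X` decided ⇒ `LocAt s X` decided. -/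
theorem decided_locAt {s : ℕ → ℕ} {X : PClass}
    (hgrow : ∀ h₀ : ℕ, ∃ h₁ : ℕ, ∀ h ≥ h₁, h₀ ≤ s h)
    (hex : ∀ c : ℕ, ∃ c' h₁ : ℕ, ∀ h ≥ h₁, ∀ ℓ, s h ≤ ℓ → T c h ≤ T c' ℓ)
    (hX : Decided X) : Decided (LocAt s X) := by
  intro c
  obtain ⟨c', h₁, hh₁⟩ := hex c
  obtain ⟨h₀, hh₀⟩ := hX c'
  obtain ⟨h₂, hh₂⟩ := hgrow h₀
  refine ⟨h₁ + h₂, fun h hh K q r hq hEF => ?_⟩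
  obtain ⟨ℓ, hℓ, ι, hx⟩ := hq
  have hℓ₀ : h₀ ≤ ℓ := le_trans (hh₂ h (by omega)) hℓ
  exact lt_of_le_of_lt (hh₁ h (by omega) ℓ hℓ) (hh₀ ℓ hℓ₀ K _ r hx (hasEFOfSize_pair_del ι q hEF))

/-- ★★ **THE LOCALIZATION THEOREM** (`√h` minors, exchange `c ↦ 2c`): `X` decided ⇒ `Loc X` decided. -/
theorem decided_loc {X : PClass} (hX : Decided X) : Decided (Loc X) := by
  refine decided_locAt (s := Nat.sqrt) ?_ ?_ hX
  · intro h₀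
    refine ⟨h₀ * h₀, fun h hh => ?_⟩
    have e : Nat.sqrt (h₀ * h₀) = h₀ := Nat.sqrt_eq h₀
    calc h₀ = Nat.sqrt (h₀ * h₀) := e.symm
      _ ≤ Nat.sqrt h := Nat.sqrt_le_sqrt hh
  · intro c
    exact ⟨2 * c, 0, fun h _ ℓ hℓ => T_le_T_double c hℓ⟩

/-- iterating: `h^{1/4}`-minors (`Loc (Loc X)`), `h^{1/8}`-minors, … are decided too — the floor of the move in `T`-currency is
`h^ε`, NOT polylog (no constant `c'` exchanges `T c h` against `T c' ((log h)^k)`). -/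
theorem decided_loc_loc {X : PClass} (hX : Decided X) : Decided (Loc (Loc X)) :=
  decided_loc (decided_loc hX)

/-- the `h^{1/4}` scale directly (exchange `c ↦ 4c`, two square roots): `X` decided ⇒ `LocAt ⁴√· X` decided. -/
theorem decided_locAt_fourthRoot {X : PClass} (hX : Decided X) :
    Decided (LocAt (fun h => Nat.sqrt (Nat.sqrt h)) X) := by
  refine decided_locAt ?_ ?_ hX
  · intro h₀
    refine ⟨(h₀ * h₀) * (h₀ * h₀), fun h hh => ?_⟩
    have e1 : Nat.sqrt ((h₀ * h₀) * (h₀ * h₀)) = h₀ * h₀ := Nat.sqrt_eq (h₀ * h₀)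
    have e2 : Nat.sqrt (h₀ * h₀) = h₀ := Nat.sqrt_eq h₀
    have s1 : h₀ * h₀ ≤ Nat.sqrt h := by
      calc h₀ * h₀ = Nat.sqrt ((h₀ * h₀) * (h₀ * h₀)) := e1.symm
        _ ≤ Nat.sqrt h := Nat.sqrt_le_sqrt hh
    calc h₀ = Nat.sqrt (h₀ * h₀) := e2.symm
      _ ≤ Nat.sqrt (Nat.sqrt h) := Nat.sqrt_le_sqrt s1
  · intro c
    refine ⟨2 * (2 * c), 0, fun h _ ℓ hℓ => ?_⟩
    exact le_trans (T_le_T_double c (le_refl (Nat.sqrt h))) (T_le_T_double (2 * c) hℓ)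

/-! ### §3b The budget-aware variant (for class theorems that price the passenger, e.g. val-idea-41's few-zones law) -/

/-- «class `X` is DECIDED USING THE BUDGET»: as `Decided`, with the passenger's own size-`r` extended formulation as an extra hypothesis. -/
def DecidedB (X : PClass) : Prop :=
  ∀ c : ℕ, ∃ h₀ : ℕ, ∀ h ≥ h₀, ∀ (K : ℕ) (q : Fam h K) (r : ℕ),
    X h K q → HasEFOfSize (convexHull ℝ (Set.range q)) r →
    HasEFOfSize (corPolytopeGraph (⊤ : SimpleGraph (Fin h)) + convexHull ℝ (Set.range q)) r → T c h < r

/-- a decided class is budget-decided (the passenger budget hypothesis is simply dropped). -/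
theorem decidedB_of_decided {X : PClass} (hX : Decided X) : DecidedB X := by
  intro c
  obtain ⟨h₀, hh₀⟩ := hX c
  exact ⟨h₀, fun h hh K q r hq _ hEF => hh₀ h hh K q r hq hEF⟩

/-- budgets ride along the minor (`hasEFOfSize_hull_del`), so the localization theorem holds verbatim for budget-using classes. -/
theorem decidedB_locAt {s : ℕ → ℕ} {X : PClass}
    (hgrow : ∀ h₀ : ℕ, ∃ h₁ : ℕ, ∀ h ≥ h₁, h₀ ≤ s h)
    (hex : ∀ c : ℕ, ∃ c' h₁ : ℕ, ∀ h ≥ h₁, ∀ ℓ, s h ≤ ℓ → T c h ≤ T c' ℓ)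
    (hX : DecidedB X) : DecidedB (LocAt s X) := by
  intro c
  obtain ⟨c', h₁, hh₁⟩ := hex c
  obtain ⟨h₀, hh₀⟩ := hX c'
  obtain ⟨h₂, hh₂⟩ := hgrow h₀
  refine ⟨h₁ + h₂, fun h hh K q r hq hB hEF => ?_⟩
  obtain ⟨ℓ, hℓ, ι, hx⟩ := hq
  have hℓ₀ : h₀ ≤ ℓ := le_trans (hh₂ h (by omega)) hℓ
  exact lt_of_le_of_lt (hh₁ h (by omega) ℓ hℓ)
    (hh₀ ℓ hℓ₀ K _ r hx (hasEFOfSize_hull_del ι q hB) (hasEFOfSize_pair_del ι q hEF))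

/-- ★★ the localization theorem, budget-aware form. -/
theorem decidedB_loc {X : PClass} (hX : DecidedB X) : DecidedB (Loc X) := by
  refine decidedB_locAt (s := Nat.sqrt) ?_ ?_ hX
  · intro h₀
    refine ⟨h₀ * h₀, fun h hh => ?_⟩
    have e : Nat.sqrt (h₀ * h₀) = h₀ := Nat.sqrt_eq h₀
    calc h₀ = Nat.sqrt (h₀ * h₀) := e.symm
      _ ≤ Nat.sqrt h := Nat.sqrt_le_sqrt hh
  · intro c
    exact ⟨2 * c, 0, fun h _ ℓ hℓ => T_le_T_double c hℓ⟩

/-- the partition glue, budget-aware form. -/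
theorem corVirtualHard_of_residualLawB {X : PClass} (hX : DecidedB X) (hR : ResidualLaw X) : CorVirtualHard := by
  intro c
  obtain ⟨h₁, hh₁⟩ := hX c
  obtain ⟨h₂, hh₂⟩ := hR c
  refine ⟨h₁ + h₂, fun h hh K q r hB hEF => ?_⟩
  by_cases hq : X h K q
  · exact hh₁ h (by omega) K q r hq hB hEF
  · exact hh₂ h (by omega) K q r hq hB hEF

/-! ## §4 The LOCALIZED residual law reaches `CorVirtualHard` -/

/-- C♭_loc is weaker than C♭: the residual law relative to the localized cone follows from the one relative to the cone. -/
theorem residualLawLoc_of {X : PClass} (hR : ResidualLaw X) : ResidualLaw (Loc X) :=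
  residualLaw_mono (fun _ _ _ hq => le_loc X hq) hR

/-- ★★★ **THE GLUE BY NAME**: a decided cone `X` and the residual law relative to its `√h`-LOCALIZATION give `CorVirtualHard` (hence
stmt-21181 by the line's `nnDivisionHard_of_corVirtual`).  With `X :=` the line's fourteen-fold disjunction this is
`corVirtualHard_of_partition'` with the research stub WEAKENED from `CoreLaw` to its localization. -/
theorem corVirtualHard_of_residualLawLoc {X : PClass} (hX : Decided X) (hR : ResidualLaw (Loc X)) : CorVirtualHard :=
  corVirtualHard_of_residualLaw (decided_loc hX) hR

/-- … and one level deeper (`h^{1/4}`-minors). -/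
theorem corVirtualHard_of_residualLawLocLoc {X : PClass} (hX : Decided X) (hR : ResidualLaw (Loc (Loc X))) :
    CorVirtualHard :=
  corVirtualHard_of_residualLaw (decided_loc_loc hX) hR

/-- budget-aware form of the glue by name. -/
theorem corVirtualHard_of_residualLawLocB {X : PClass} (hX : DecidedB X) (hR : ResidualLaw (Loc X)) : CorVirtualHard :=
  corVirtualHard_of_residualLawB (decidedB_loc hX) hR

/-- **the localized research stub, UNFOLDED** (what the pen pastes as C♭_loc: the fourteen negations move under
«for every deletion minor of size `≥ ⌊√h⌋`»). -/
theorem residualLawLoc_iff (X : PClass) :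
    ResidualLaw (Loc X) ↔
      ∀ c : ℕ, ∃ h₀ : ℕ, ∀ h ≥ h₀, ∀ (K : ℕ) (q : Fam h K) (r : ℕ),
        (∀ ℓ : ℕ, Nat.sqrt h ≤ ℓ → ∀ ι : Fin ℓ ↪ Fin h, ¬ X ℓ K (⇑(delRead ι) ∘ q)) →
        HasEFOfSize (convexHull ℝ (Set.range q)) r →
        HasEFOfSize (corPolytopeGraph (⊤ : SimpleGraph (Fin h)) + convexHull ℝ (Set.range q)) r → T c h < r := by
  unfold ResidualLaw
  simp only [not_loc_iff]

/-- the contrapositive the R-seats use: a cheap budgeted pair BELOW the threshold at a large scale lies outside `X` on every `√h`-minor. -/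
theorem enemy_hereditary {X : PClass} (hX : Decided X) (c : ℕ) :
    ∃ h₀ : ℕ, ∀ h ≥ h₀, ∀ (K : ℕ) (q : Fam h K) (r : ℕ),
      HasEFOfSize (corPolytopeGraph (⊤ : SimpleGraph (Fin h)) + convexHull ℝ (Set.range q)) r → r ≤ T c h →
      ∀ ℓ : ℕ, Nat.sqrt h ≤ ℓ → ∀ ι : Fin ℓ ↪ Fin h, ¬ X ℓ K (⇑(delRead ι) ∘ q) := by
  obtain ⟨h₀, hh₀⟩ := decided_loc hX c
  refine ⟨h₀, fun h hh K q r hEF hr => ?_⟩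
  rw [← not_loc_iff]
  intro hq
  exact absurd (hh₀ h hh K q r hq hEF) (not_lt.2 hr)

end Summit.ValiantsHypothesis.ValiantsHypothesis.Theorems.FifoMatching.Localization
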